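import Mathlib
import HarnessLib.Audit
import Summits.PneNP.PneNP.Theorems.PstarChordBridgeBasis
import Summits.PneNP.PneNP.Theorems.PstarChordBridgeCollapse

/-!
# The regime theorem for bundle-free cores (ROUND-24, memo §9 R4–R7; corollary of `PstarChordBridgeBasis` + `PstarChordBridgeCollapse`)

FRONTIER range-avoidance ladder, rung F-N3, ROUND 24 (cell `pnp-ideate`, planner memo `r24/CORE-BOUND-NOTES.md` §7 G2′ / §9 R4–R7; restricted-model
proof complexity — nothing here bears on `P` versus `NP`).

`PstarChordBridgeBasis.regime_cases` assumes pairwise killability of the chords; `PstarChordBridgeCollapse.killable_pair_or_exc` (R4) supplies it for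
every pair that is not an ELLIPTIC BUNDLE.  So for BUNDLE-FREE cores the regime theorem holds outright (`regime_cases_of_bundleFree`).  The calibration
core CONS-P3 is NOT bundle-free (its two chords differ by the two `σ`-edges: `Q' = Q + x_σ (x_b + x_{b'})`), but its chords are killable together, so it is
covered by `regime_cases` directly; bundles that are not commonly killable are the residual (EXC) case of the line.
-/

set_option linter.dupNamespace false -- `Summit.PneNP.PneNP.…`: summit = sub-problem name (D-0017 single-conjunct layout)

open Finset Module Literature.Computability.Complexity
open Summit.PneNP.PneNP.Theorems.PstarFibrePolys (bit)
open Summit.PneNP.PneNP.Theorems.PstarTyped (Typed)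
open Summit.PneNP.PneNP.Theorems.PstarSALevel (varSet bdry BoundaryExpanding SimpleOverlap)
open Summit.PneNP.PneNP.Theorems.PstarCubeIdeals (IsAffineFn)
open Summit.PneNP.PneNP.Theorems.PstarProductRank (qform polar)
open Summit.PneNP.PneNP.Theorems.PstarReadSumset (V2)
open Summit.PneNP.PneNP.Theorems.PstarChordSystem (ChordSystem)
open Summit.PneNP.PneNP.Theorems.PstarChordBridgeTools
open Summit.PneNP.PneNP.Theorems.PstarChordBridge
open Summit.PneNP.PneNP.Theorems.PstarChordBridgeForcing
open Summit.PneNP.PneNP.Theorems.PstarChordBridgeCollapse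
open Summit.PneNP.PneNP.Theorems.PstarChordBridgeBasis

namespace Summit.PneNP.PneNP.Theorems.PstarChordBridgeRegime

variable {n m : ℕ}

/-- **Bundle-free cores have pairwise killable chords** (R4, `PstarChordBridgeCollapse.killable_pair_or_exc`). -/
theorem killable_of_bundleFree (I : LocalMap 4 n m) (hI : I.IsPure xorAndPred) (hS : SimpleOverlap I) {r : ℕ} (hB : BoundaryExpanding r I)
    {B : BridgeData n m} (hW : B.WF I) (hr : B.J₀.card ≤ r) (hnb : ∀ e ∈ B.N, ∀ e' ∈ B.N, e ≠ e' → ¬ Bundle I B e e') :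
    ∀ e ∈ B.N, ∀ e' ∈ B.N, e ≠ e' → ∃ a, (sys I B).u e a = 0 ∧ (sys I B).u e' a = 0 := fun e he e' he' hne => by
  rcases killable_pair_or_exc I hI hS hB hW hr he he' hne with h | h
  · exact h
  · exact absurd h (hnb e he e' he' hne)

/-- **Regime theorem for bundle-free cores**: `PstarChordBridgeBasis.regime_cases` with pairwise killability supplied by R4. -/
theorem regime_cases_of_bundleFree (I : LocalMap 4 n m) (hI : I.IsPure xorAndPred) (hT : Typed I) (hS : SimpleOverlap I) {r : ℕ}
    (hB : BoundaryExpanding r I) {B : BridgeData n m} (hW : B.WF I) (hr : B.J₀.card ≤ r) (hL : Lift I B)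
    (hun : ∀ v ∈ privs I B.N, (∀ g ∈ B.G₁, I.vars g 2 ≠ v ∧ I.vars g 3 ≠ v) ∧ ∀ g ∈ B.G₂, I.vars g 2 ≠ v ∧ I.vars g 3 ≠ v)
    (hnb : ∀ e ∈ B.N, ∀ e' ∈ B.N, e ≠ e' → ¬ Bundle I B e e')
    (hT3 : ¬ ∃ z, Solution I B B.J₀ z) (hM0 : ∀ e ∈ B.N, ∃ z, Solution I B (B.J₀.erase e) z) :
    (∃ e₀, B.N = {e₀} ∧ (sys I B).ρ e₀ 0 ≠ 0 ∧ (sys I B).ρ' e₀ 0 ≠ 0 ∧ (sys I B).ρ e₀ 0 ≠ (sys I B).ρ' e₀ 0) ∨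
    (∃ mv : V2, mv ≠ 0 ∧ (∀ e ∈ B.N, ((sys I B).ρ e 0 = 0 ∨ (sys I B).ρ e 0 = mv) ∧ ((sys I B).ρ' e 0 = 0 ∨ (sys I B).ρ' e 0 = mv)) ∧
      ∀ e ∈ B.N,
        (∃ κ : ZMod 2, ∀ x, qform (B.D e) (fun j => I.vars j 2) (fun j => I.vars j 3) x = qDir I B mv x + κ) ∨
        (∃ ν₁ ν₂ : (Fin n → ZMod 2) → ZMod 2, IsAffineFn ν₁ ∧ IsAffineFn ν₂ ∧ ∃ κ : ZMod 2, ∀ x,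
          qform (B.D e) (fun j => I.vars j 2) (fun j => I.vars j 3) x = qDir I B mv x + ν₁ x * ν₂ x + κ) ∨
        (∃ a b : Fin n → ZMod 2, polarDir I B mv a b = 1 ∧
          (∀ x, qDir I B mv x =
            (polarDir I B mv x b + (qDir I B mv b + qDir I B mv 0)) * (polarDir I B mv x a + (qDir I B mv a + qDir I B mv 0)) + 1) ∧
          ∃ m₁ m₂ : (Fin n → ZMod 2) → ZMod 2, IsAffineFn m₁ ∧ IsAffineFn m₂ ∧
            ∀ x, qform (B.D e) (fun j => I.vars j 2) (fun j => I.vars j 3) x + (gam B e + 1) =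
              (polarDir I B mv x b + (qDir I B mv b + qDir I B mv 0) + 1) * m₁ x +
              (polarDir I B mv x a + (qDir I B mv a + qDir I B mv 0) + 1) * m₂ x)) :=
  regime_cases I hI hT hS hB hW hr hL hun (killable_of_bundleFree I hI hS hB hW hr hnb) hT3 hM0

end Summit.PneNP.PneNP.Theorems.PstarChordBridgeRegime
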